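import Literature.NumberTheory.Sieve.SmoothArcPrincipal
import Mathlib.NumberTheory.DirichletCharacter.Orthogonality
import Mathlib.RingTheory.RootsOfUnity.AlgebraicallyClosed
import Mathlib.Analysis.Complex.Polynomial.Basic
import HarnessLib

/-!
# Smooth-weighted exponential sums over a residue class at `h/k + λ/X`: definitions and characters

Topic `Literature/NumberTheory/Sieve`; a PROVED algebraic tool file (class-restricted companion of
`SmoothArcCharacters` / `SmoothArcPrincipal`, [Harper2016, §2.2, §5] and [MontgomeryVaughanActa1975, §5–6]).
With `W_λ(v) = v²(1−v)² e(λv)` (`TwistedWeight.twistWeight`), `S(X, y)` the `y`-friable integers `≤ X`,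
a modulus `m ≥ 1`, a class `r (mod m)`, a denominator `k ≥ 1`, ANY integer numerator `h`, and
`L = lcm(k, m)`:

* `classArcSum X y m r k h λ = ∑_{n ∈ S(X,y), n ≡ r (m)} e(hn/k) W_λ(n/X)`;
* `classLocalFactor α m r k h = ∑_{t mod L, t ≡ r (m)} e(ht/k) g_t^{−α} ∏_{p ∣ L/g_t} (1 − p^{−α}) / φ(L/g_t)`,
  `g_t = (t, L)`, the local factor of its saddle-point main term, and the majorant
  `classLocalH α m r k = ∑_{t mod L, t ≡ r (m)} g_t^{−α} τ(L/g_t)/φ(L/g_t)` of the principal error;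
* `classArcSum_eq_sum_mod` (step 0): `classArcSum = ∑_{t mod L, t ≡ r (m)} e(ht/k) V(t)`,
  `V(t) = ∑_{n ∈ S(X,y), n ≡ t (L)} W_λ(n/X)` (`e(hn/k)` depends on `n mod k`, `k ∣ L`, `m ∣ L`);
* `filter_mod_eq_image`, `sum_filter_mod_eq` (step 1): with `g = (t, L)`, `L' = L/g`, `t' = t/g`,
  `V(t) = ∑_{n' ∈ S(X/g, y), n' ≡ t' (L')} W_λ(n'/(X/g))` when `L ∈ S(y)`;
* `sum_filter_modEq_eq_sum_char`, `classFiber_eq` (step 2, orthogonality of the characters mod `L'`,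
  `(t', L') = 1`): `V = φ(L')⁻¹ U(X/g, L') + φ(L')⁻¹ ∑_{ψ ≠ ψ₀} ψ(t'⁻¹) ∑_{n'} ψ(n') W_λ(n'/(X/g))`
  with `U` = `coprimeTwistSum`;
* sanity (`m = 1`): `classArcSum_one_eq_arcSum` (the class sum is `arcSum`) and
  `classLocalFactor_one_eq_localG`: `classLocalFactor α 1 r k a = G_α(k)` (`localG`) for `(a, k) = 1`,
  via `filter_range_gcd_eq_image` and von Sterneck's `∑_{b < q, (b,q)=1} e(ab/q) = μ(q)`
  (`sum_coprime_fourierChar_eq_moebius`, from `charGauss_one_eq`).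

The estimate (saddle-point main term `×` `classLocalFactor`, errors `∝ classLocalH` and a GRH-type
character-sum currency) is `classArcSum_estimate` in `SmoothArcClassesEstimate`. The definitions are
meant for `k, m ≥ 1` (for `k = 0` the phase is `e(0) = 1`, for `m = 0` the class condition is `n = r`).

## References

* A. J. Harper, Compositio Math. 152 (2016), §2.2, §5 [Harper2016].
* H. L. Montgomery, R. C. Vaughan, Acta Arith. 27 (1975), §5–6 [MontgomeryVaughanActa1975].
-/

noncomputable section

open Finset Real Complex
open scoped ArithmeticFunction.Moebius FourierTransform

namespace Literature.NumberTheory.Sieve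

namespace SmoothArcs

open MontgomeryVaughan1975 TwistedWeight

/-! ### The class-restricted sum and its local factors -/

/-- Class-restricted arc sum `Σ_{n ∈ S(X,y), n ≡ r (mod m)} e(hn/k) W_λ(n/X)` (`h ∈ ℤ` arbitrary, not
necessarily prime to `k`; intended for `k, m ≥ 1`). [cite: Harper2016, §5] -/
def classArcSum (X : ℝ) (y m r k : ℕ) (h : ℤ) (lam : ℝ) : ℂ :=
  ∑ n ∈ (Nat.smoothNumbersUpTo ⌊X⌋₊ (y + 1)).filter (fun n => n ≡ r [MOD m]),
    (𝐞 ((h * n : ℝ) / k) : ℂ) * twistWeight lam (n / X)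

/-- Its local factor `Σ_{t mod L, t ≡ r (m)} e(ht/k) · g_t^{−α} Π_{p ∣ L/g_t}(1 − p^{−α}) / φ(L/g_t)`, `L = lcm(k,m)`,
`g_t = gcd(t, L)` (so the class `t = 0` has `g_0 = L` and contributes `L^{−α}`); for `m = 1` this is `localG α k`
when `(h, k) = 1` (`classLocalFactor_one_eq_localG`). [cite: Harper2016, §2.2] -/
def classLocalFactor (α : ℝ) (m r k : ℕ) (h : ℤ) : ℂ :=
  ∑ t ∈ (Finset.range (Nat.lcm k m)).filter (fun t => t ≡ r [MOD m]),
    (𝐞 ((h * t : ℝ) / k) : ℂ) *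
      ((((Nat.gcd t (Nat.lcm k m) : ℕ) : ℝ) ^ (-α) *
          (∏ p ∈ (Nat.lcm k m / Nat.gcd t (Nat.lcm k m)).primeFactors, (1 - (p : ℝ) ^ (-α))) /
          ((Nat.lcm k m / Nat.gcd t (Nat.lcm k m)).totient : ℝ) : ℝ) : ℂ)

/-- The majorant of the principal-part error: `Σ_{t mod L, t ≡ r (m)} g_t^{−α} τ(L/g_t)/φ(L/g_t)` (τ = number of divisors).
[cite: Harper2016, §2.2] -/
def classLocalH (α : ℝ) (m r k : ℕ) : ℝ :=
  ∑ t ∈ (Finset.range (Nat.lcm k m)).filter (fun t => t ≡ r [MOD m]),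
    ((Nat.gcd t (Nat.lcm k m) : ℕ) : ℝ) ^ (-α) * ((Nat.lcm k m / Nat.gcd t (Nat.lcm k m)).divisors.card : ℝ) /
      ((Nat.lcm k m / Nat.gcd t (Nat.lcm k m)).totient : ℝ)

/-! ### Step 0: grouping `n` by its residue mod `L = lcm(k, m)` -/

/-- `e(hn/k) = e(ht/k)` when `n % L = t` and `k ∣ L`, `k ≥ 1`. [folklore] -/
theorem fourierChar_mul_div_of_mod_eq {k L n t : ℕ} (hk0 : k ≠ 0) (hk : k ∣ L) (hn : n % L = t) (h : ℤ) :
    (𝐞 ((h * n : ℝ) / k) : ℂ) = (𝐞 ((h * t : ℝ) / k) : ℂ) := by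
  obtain ⟨c, rfl⟩ := hk
  set q : ℕ := n / (k * c) with hq
  have hdecomp : (n : ℝ) = t + (k : ℝ) * ((c * q : ℕ) : ℝ) := by
    have h1 : t + k * c * q = n := by rw [← hn]; exact Nat.mod_add_div n (k * c)
    have h2 : (n : ℝ) = ((t + k * c * q : ℕ) : ℝ) := by rw [h1]
    rw [h2]; push_cast; ring
  have hk0' : (k : ℝ) ≠ 0 := by exact_mod_cast hk0
  set z : ℤ := h * ((c * q : ℕ) : ℤ) with hz
  have hsplit : (h * n : ℝ) / k = (h * t : ℝ) / k + (z : ℝ) := by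
    rw [hdecomp, hz]; push_cast; field_simp
  rw [hsplit, AddChar.map_add_eq_mul, Circle.coe_mul, RamanujanSum.fourierChar_intCast, mul_one]

/-- **Step 0.** For `k, m ≥ 1`, `L = lcm(k, m)`:
`classArcSum = ∑_{t < L, t ≡ r (m)} e(ht/k) ∑_{n ∈ S(X,y), n % L = t} W_λ(n/X)`. [folklore] -/
theorem classArcSum_eq_sum_mod (X : ℝ) (y : ℕ) {m k : ℕ} (hm : m ≠ 0) (hk : k ≠ 0) (r : ℕ) (h : ℤ) (lam : ℝ) :
    classArcSum X y m r k h lam =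
      ∑ t ∈ (Finset.range (Nat.lcm k m)).filter (fun t => t ≡ r [MOD m]),
        (𝐞 ((h * t : ℝ) / k) : ℂ) *
          ∑ n ∈ (Nat.smoothNumbersUpTo ⌊X⌋₊ (y + 1)).filter (fun n => n % Nat.lcm k m = t),
            twistWeight lam (n / X) := by
  set L := Nat.lcm k m with hL
  have hL0 : 0 < L := Nat.lcm_pos (Nat.pos_of_ne_zero hk) (Nat.pos_of_ne_zero hm)
  have hmL : m ∣ L := Nat.dvd_lcm_right k m
  have hkL : k ∣ L := Nat.dvd_lcm_left k m
  unfold classArcSum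
  rw [← Finset.sum_fiberwise_of_maps_to (g := fun n => n % L)
    (t := (Finset.range L).filter (fun t => t ≡ r [MOD m]))]
  · refine Finset.sum_congr rfl fun t ht => ?_
    obtain ⟨-, htr⟩ := Finset.mem_filter.mp ht
    rw [Finset.mul_sum, Finset.filter_filter]
    have hfib : (Nat.smoothNumbersUpTo ⌊X⌋₊ (y + 1)).filter (fun n => n ≡ r [MOD m] ∧ n % L = t) =
        (Nat.smoothNumbersUpTo ⌊X⌋₊ (y + 1)).filter (fun n => n % L = t) := by
      refine Finset.filter_congr fun n _ => ⟨fun hn => hn.2, fun hn => ⟨?_, hn⟩⟩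
      have h1 : n ≡ t [MOD m] := by
        unfold Nat.ModEq
        rw [← Nat.mod_mod_of_dvd n hmL, hn]
      exact h1.trans htr
    rw [hfib]
    refine Finset.sum_congr rfl fun n hn => ?_
    obtain ⟨-, hnt⟩ := Finset.mem_filter.mp hn
    rw [fourierChar_mul_div_of_mod_eq hk hkL hnt]
  · intro n hn
    obtain ⟨-, hnr⟩ := Finset.mem_filter.mp hn
    refine Finset.mem_filter.mpr ⟨Finset.mem_range.mpr (Nat.mod_lt n hL0), ?_⟩
    unfold Nat.ModEq at hnr ⊢
    rw [Nat.mod_mod_of_dvd n hmL, hnr]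

/-! ### Step 1: the fibre `n ≡ t (mod L)` rescaled by `g = (t, L)` -/

/-- For `t < L`, `g = (t, L)`, `L' = L/g`, `t' = t/g` and `L ∈ S(y)`: the `y`-friable `n ≤ X` with
`n % L = t` are exactly the `g n'` with `n' ∈ S(X/g, y)`, `n' ≡ t' (mod L')`. [folklore] -/
theorem filter_mod_eq_image {X : ℝ} (hX : 0 ≤ X) {y L t : ℕ} (hL : L ≠ 0) (ht : t < L)
    (hLS : L ∈ Nat.smoothNumbers (y + 1)) :
    (Nat.smoothNumbersUpTo ⌊X⌋₊ (y + 1)).filter (fun n => n % L = t) =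
      ((Nat.smoothNumbersUpTo ⌊X / Nat.gcd t L⌋₊ (y + 1)).filter
        (fun n' => n' ≡ t / Nat.gcd t L [MOD L / Nat.gcd t L])).image (fun n' => Nat.gcd t L * n') := by
  set g := Nat.gcd t L with hg
  have hg0 : 0 < g := Nat.gcd_pos_of_pos_right t (Nat.pos_of_ne_zero hL)
  obtain ⟨t', ht'⟩ : g ∣ t := Nat.gcd_dvd_left t L
  obtain ⟨L', hL'⟩ : g ∣ L := Nat.gcd_dvd_right t L
  have htg : t / g = t' := by rw [ht', Nat.mul_div_cancel_left t' hg0]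
  have hLg : L / g = L' := by rw [hL', Nat.mul_div_cancel_left L' hg0]
  rw [htg, hLg]
  have hgS : g ∈ Nat.smoothNumbers (y + 1) := Nat.mem_smoothNumbers_of_dvd hLS (Nat.gcd_dvd_right t L)
  have hg0' : (0 : ℝ) < g := by exact_mod_cast hg0
  ext n
  simp only [Finset.mem_filter, Finset.mem_image, Nat.mem_smoothNumbersUpTo]
  constructor
  · rintro ⟨⟨hnx, hnS⟩, hnt⟩
    set q : ℕ := n / L with hq
    have h1 : t + L * q = n := by rw [← hnt]; exact Nat.mod_add_div n L
    have hn : n = g * (t' + L' * q) := by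
      calc n = t + L * q := h1.symm
        _ = g * t' + g * L' * q := by rw [← ht', ← hL']
        _ = g * (t' + L' * q) := by ring
    refine ⟨t' + L' * q, ⟨⟨?_, ?_⟩, ?_⟩, hn.symm⟩
    · rw [Nat.le_floor_iff (by positivity), le_div_iff₀ hg0']
      have h2 := (Nat.le_floor_iff hX).mp hnx
      rw [hn] at h2
      push_cast at h2 ⊢
      linarith
    · exact Nat.mem_smoothNumbers_of_dvd hnS ⟨g, by rw [mul_comm]; exact hn⟩
    · unfold Nat.ModEq
      rw [Nat.add_mul_mod_self_left]
  · rintro ⟨n', ⟨⟨hn'x, hn'S⟩, hmod⟩, rfl⟩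
    refine ⟨⟨?_, Nat.mul_mem_smoothNumbers hgS hn'S⟩, ?_⟩
    · rw [Nat.le_floor_iff hX]
      have h2 := (Nat.le_floor_iff (by positivity)).mp hn'x
      rw [le_div_iff₀ hg0'] at h2
      push_cast
      linarith
    · have h1 : g * n' ≡ t [MOD L] := by rw [ht', hL']; exact Nat.ModEq.mul_left' g hmod
      unfold Nat.ModEq at h1
      rw [h1, Nat.mod_eq_of_lt ht]

/-- **Step 1.** `∑_{n ∈ S(X,y), n % L = t} W_λ(n/X) = ∑_{n' ∈ S(X/g,y), n' ≡ t' (L')} W_λ(n'/(X/g))`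
(`g = (t, L)`, `L' = L/g`, `t' = t/g`, `t < L`, `L ∈ S(y)`). [folklore] -/
theorem sum_filter_mod_eq {X : ℝ} (hX : 0 ≤ X) {y L t : ℕ} (hL : L ≠ 0) (ht : t < L)
    (hLS : L ∈ Nat.smoothNumbers (y + 1)) (lam : ℝ) :
    ∑ n ∈ (Nat.smoothNumbersUpTo ⌊X⌋₊ (y + 1)).filter (fun n => n % L = t), twistWeight lam (n / X) =
      ∑ n' ∈ (Nat.smoothNumbersUpTo ⌊X / Nat.gcd t L⌋₊ (y + 1)).filter
        (fun n' => n' ≡ t / Nat.gcd t L [MOD L / Nat.gcd t L]), twistWeight lam (n' / (X / Nat.gcd t L)) := by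
  have hg0 : 0 < Nat.gcd t L := Nat.gcd_pos_of_pos_right t (Nat.pos_of_ne_zero hL)
  rw [filter_mod_eq_image hX hL ht hLS, Finset.sum_image (fun a _ b _ hab => (Nat.mul_right_inj hg0.ne').mp hab)]
  refine Finset.sum_congr rfl fun n' _ => ?_
  have hdiv : ((Nat.gcd t L * n' : ℕ) : ℝ) / X = (n' : ℝ) / (X / Nat.gcd t L) := by
    have : ((Nat.gcd t L : ℕ) : ℝ) ≠ 0 := by exact_mod_cast hg0.ne'
    push_cast
    field_simp
  rw [hdiv]

/-! ### Step 2: characters mod `L'` -/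

/-- **Orthogonality.** For `L' ≥ 1` and `(t', L') = 1`:
`∑_{n ∈ S(X,y), n ≡ t' (L')} W_λ(n/X) = φ(L')⁻¹ ∑_ψ ψ(t'⁻¹) ∑_{n ∈ S(X,y)} ψ(n) W_λ(n/X)`.
[cite: MontgomeryVaughanActa1975, §6 (6.1)] -/
theorem sum_filter_modEq_eq_sum_char (X : ℝ) (y : ℕ) {L' : ℕ} [NeZero L'] {t' : ℕ} (ht : t'.Coprime L')
    (lam : ℝ) :
    ∑ n ∈ (Nat.smoothNumbersUpTo ⌊X⌋₊ (y + 1)).filter (fun n => n ≡ t' [MOD L']), twistWeight lam (n / X) =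
      ((L'.totient : ℂ))⁻¹ * ∑ ψ : DirichletCharacter ℂ L',
        ψ ((t' : ZMod L')⁻¹) *
          ∑ n ∈ Nat.smoothNumbersUpTo ⌊X⌋₊ (y + 1), ψ (n : ZMod L') * twistWeight lam (n / X) := by
  have hu : IsUnit (t' : ZMod L') := (ZMod.isUnit_iff_coprime t' L').mpr ht
  have hφ : (L'.totient : ℂ) ≠ 0 := by exact_mod_cast (Nat.totient_pos.mpr (NeZero.pos L')).ne'
  have key : ∀ n : ℕ, ∑ ψ : DirichletCharacter ℂ L',
      ψ ((t' : ZMod L')⁻¹) * (ψ (n : ZMod L') * twistWeight lam (n / X)) =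
      (if (t' : ZMod L') = (n : ZMod L') then (L'.totient : ℂ) else 0) * twistWeight lam (n / X) := by
    intro n
    rw [← DirichletCharacter.sum_char_inv_mul_char_eq ℂ hu, Finset.sum_mul]
    refine Finset.sum_congr rfl fun ψ _ => by ring
  have key' : ∑ ψ : DirichletCharacter ℂ L', ψ ((t' : ZMod L')⁻¹) *
      ∑ n ∈ Nat.smoothNumbersUpTo ⌊X⌋₊ (y + 1), ψ (n : ZMod L') * twistWeight lam (n / X) =
      (L'.totient : ℂ) * ∑ n ∈ (Nat.smoothNumbersUpTo ⌊X⌋₊ (y + 1)).filter (fun n => n ≡ t' [MOD L']),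
        twistWeight lam (n / X) := by
    simp_rw [Finset.mul_sum]
    rw [Finset.sum_comm]
    simp_rw [key]
    rw [Finset.sum_filter]
    refine Finset.sum_congr rfl fun n _ => ?_
    by_cases hn : n ≡ t' [MOD L']
    · have h1 : (t' : ZMod L') = (n : ZMod L') := (ZMod.natCast_eq_natCast_iff _ _ _).mpr hn.symm
      rw [if_pos hn, if_pos h1]
    · have h1 : (t' : ZMod L') ≠ (n : ZMod L') := fun h' => hn ((ZMod.natCast_eq_natCast_iff _ _ _).mp h').symm
      rw [if_neg hn, if_neg h1, zero_mul]
  rw [key', ← mul_assoc, inv_mul_cancel₀ hφ, one_mul]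

/-- The principal character gives `U(X, L') = ∑_{n ∈ S(X,y), (n, L') = 1} W_λ(n/X)`. [folklore] -/
theorem sum_one_apply_mul_twistWeight (X : ℝ) (y L' : ℕ) [NeZero L'] (lam : ℝ) :
    ∑ n ∈ Nat.smoothNumbersUpTo ⌊X⌋₊ (y + 1), (1 : DirichletCharacter ℂ L') (n : ZMod L') * twistWeight lam (n / X) =
      coprimeTwistSum X y L' lam := by
  rw [coprimeTwistSum, Finset.sum_filter]
  refine Finset.sum_congr rfl fun n _ => ?_
  by_cases hc : n.Coprime L'
  · rw [if_pos hc, MulChar.one_apply ((ZMod.isUnit_iff_coprime n L').mpr hc), one_mul]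
  · rw [if_neg hc, MulChar.map_nonunit _ (mt (ZMod.isUnit_iff_coprime n L').mp hc), zero_mul]

/-- **Step 2.** For `L' ≥ 1`, `(t', L') = 1`:
`∑_{n ∈ S(X,y), n ≡ t' (L')} W_λ(n/X) = φ(L')⁻¹ U(X, L') + φ(L')⁻¹ ∑_{ψ ≠ ψ₀} ψ(t'⁻¹) ∑_{n ∈ S(X,y)} ψ(n) W_λ(n/X)`.
[cite: MontgomeryVaughanActa1975, §6 (6.1)] -/
theorem classFiber_eq (X : ℝ) (y : ℕ) {L' : ℕ} [NeZero L'] {t' : ℕ} (ht : t'.Coprime L') (lam : ℝ) :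
    ∑ n ∈ (Nat.smoothNumbersUpTo ⌊X⌋₊ (y + 1)).filter (fun n => n ≡ t' [MOD L']), twistWeight lam (n / X) =
      ((L'.totient : ℂ))⁻¹ * coprimeTwistSum X y L' lam +
        ((L'.totient : ℂ))⁻¹ * ∑ ψ ∈ (Finset.univ : Finset (DirichletCharacter ℂ L')).erase 1,
          ψ ((t' : ZMod L')⁻¹) *
            ∑ n ∈ Nat.smoothNumbersUpTo ⌊X⌋₊ (y + 1), ψ (n : ZMod L') * twistWeight lam (n / X) := by
  rw [sum_filter_modEq_eq_sum_char X y ht lam,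
    ← Finset.add_sum_erase _ _ (Finset.mem_univ (1 : DirichletCharacter ℂ L')), mul_add,
    sum_one_apply_mul_twistWeight]
  have hu : IsUnit (t' : ZMod L') := (ZMod.isUnit_iff_coprime t' L').mpr ht
  have hu' : IsUnit ((t' : ZMod L')⁻¹) := IsUnit.of_mul_eq_one _ (ZMod.inv_mul_of_unit _ hu)
  rw [MulChar.one_apply hu', one_mul]

/-! ### Sanity checks: the case `m = 1` -/

/-- For `m = 1` the class restriction is void: `classArcSum X y 1 r k a λ = S(a/k + λ/X)` (`arcSum`).
[folklore] -/
theorem classArcSum_one_eq_arcSum (X : ℝ) (y r k a : ℕ) (lam : ℝ) :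
    classArcSum X y 1 r k (a : ℤ) lam = arcSum X y k a lam := by
  unfold classArcSum arcSum
  rw [Finset.filter_true_of_mem (fun n _ => Nat.modEq_one)]
  simp only [Int.cast_natCast]

/-- `classLocalFactor α 1 r 1 h = 1` (`= G_α(1)`). [folklore] -/
theorem classLocalFactor_one_one (α : ℝ) (r : ℕ) (h : ℤ) : classLocalFactor α 1 r 1 h = 1 := by
  unfold classLocalFactor
  rw [Nat.lcm_one_right, Finset.filter_true_of_mem (fun n _ => Nat.modEq_one)]
  simp

/-- `classLocalH α 1 r 1 = 1` (`= H_α(1)`). [folklore] -/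
theorem classLocalH_one_one (α : ℝ) (r : ℕ) : classLocalH α 1 r 1 = 1 := by
  unfold classLocalH
  rw [Nat.lcm_one_right, Finset.filter_true_of_mem (fun n _ => Nat.modEq_one)]
  simp

/-- The fibre `{t < k : (t, k) = g}` is `{g b : b < k/g, (b, k/g) = 1}` for `g ∣ k`, `k ≥ 1`. [folklore] -/
theorem filter_range_gcd_eq_image {k g : ℕ} (hk : k ≠ 0) (hg : g ∣ k) :
    (Finset.range k).filter (fun t => Nat.gcd t k = g) =
      ((Finset.range (k / g)).filter (fun b => b.Coprime (k / g))).image (fun b => g * b) := by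
  have hg0 : 0 < g := Nat.pos_of_dvd_of_pos hg (Nat.pos_of_ne_zero hk)
  obtain ⟨k', rfl⟩ := hg
  rw [Nat.mul_div_cancel_left k' hg0]
  ext t
  simp only [Finset.mem_filter, Finset.mem_range, Finset.mem_image]
  constructor
  · rintro ⟨ht, htg⟩
    have hgt : g ∣ t := htg ▸ Nat.gcd_dvd_left t (g * k')
    obtain ⟨b, rfl⟩ := hgt
    rw [Nat.gcd_mul_left] at htg
    refine ⟨b, ⟨Nat.lt_of_mul_lt_mul_left ht, ?_⟩, rfl⟩
    exact (Nat.mul_right_inj hg0.ne').mp (htg.trans (mul_one g).symm)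
  · rintro ⟨b, ⟨hb, hcop⟩, rfl⟩
    refine ⟨Nat.mul_lt_mul_of_pos_left hb hg0, ?_⟩
    rw [Nat.gcd_mul_left, Nat.Coprime.gcd_eq_one hcop, mul_one]

/-- **von Sterneck at a coprime argument**: `∑_{b < q, (b, q) = 1} e(ab/q) = μ(q)` for `(a, q) = 1`,
`q ≥ 1` (`c_q(a) = μ(q/(q,a)) φ(q)/φ(q/(q,a))`, `charGauss_one_eq`). [cite: MontgomeryVaughanActa1975, §5 (5.2)] -/
theorem sum_coprime_fourierChar_eq_moebius {q : ℕ} (hq : q ≠ 0) {a : ℕ} (ha : a.Coprime q) :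
    ∑ b ∈ (Finset.range q).filter (fun b => b.Coprime q), (𝐞 ((a * b : ℝ) / q) : ℂ) = (μ q : ℂ) := by
  haveI : NeZero q := ⟨hq⟩
  rcases Nat.eq_zero_or_pos a with rfl | ha0
  · have hq1 : q = 1 := by simpa using ha
    subst hq1
    simp
  · have h1 : ∑ b ∈ (Finset.range q).filter (fun b => b.Coprime q), (𝐞 ((a * b : ℝ) / q) : ℂ) =
        ∑ x : ZMod q, (1 : DirichletCharacter ℂ q) x * ZMod.stdAddChar ((a : ZMod q) * x) := by
      rw [← sum_range_eq_sum_zmod (fun x => (1 : DirichletCharacter ℂ q) x * ZMod.stdAddChar ((a : ZMod q) * x)),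
        Finset.sum_filter]
      refine Finset.sum_congr rfl fun b _ => ?_
      by_cases hb : b.Coprime q
      · rw [if_pos hb, MulChar.one_apply ((ZMod.isUnit_iff_coprime b q).mpr hb), one_mul,
          show ((a * b : ℝ) / q) = (((a * b : ℕ) : ℤ) : ℝ) / q by push_cast; ring, fourierChar_div_eq_stdAddChar']
        push_cast
        ring_nf
      · rw [if_neg hb, MulChar.map_nonunit _ (mt (ZMod.isUnit_iff_coprime b q).mp hb), zero_mul]
    rw [h1, ← charGauss_eq_sum, charGauss_one_eq ha0.ne']
    have hred : redMod q a = q := by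
      rw [redMod, Nat.gcd_comm, Nat.Coprime.gcd_eq_one ha, Nat.div_one]
    rw [hred, Nat.div_self (Nat.totient_pos.mpr (NeZero.pos q))]
    push_cast
    ring

/-- **Sanity (`m = 1`).** For `k ≥ 1` and `(a, k) = 1`: `classLocalFactor α 1 r k a = G_α(k)` (`localG`):
grouping `t` by `g = (t, k)`, the phases add up to `c_{k/g}(a) = μ(k/g)`, and
`∑_{d ∣ k/g} μ(d) d^{−α} = ∏_{p ∣ k/g}(1 − p^{−α})` (`sum_divisors_moebius_rpow`). [cite: Harper2016, §2.2] -/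
theorem classLocalFactor_one_eq_localG (α : ℝ) (r : ℕ) {k : ℕ} (hk : k ≠ 0) {a : ℕ} (ha : a.Coprime k) :
    classLocalFactor α 1 r k a = (localG α k : ℂ) := by
  unfold classLocalFactor
  rw [Nat.lcm_one_right, Finset.filter_true_of_mem (fun n _ => Nat.modEq_one)]
  simp only [Int.cast_natCast]
  rw [← Finset.sum_fiberwise_of_maps_to (g := fun t => Nat.gcd t k) (t := k.divisors)
    (fun t _ => Nat.mem_divisors.mpr ⟨Nat.gcd_dvd_right t k, hk⟩), localG, Complex.ofReal_sum]
  refine Finset.sum_congr rfl fun g hg => ?_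
  have hgk : g ∣ k := Nat.dvd_of_mem_divisors hg
  have hg0 : 0 < g := Nat.pos_of_mem_divisors hg
  have hk'0 : k / g ≠ 0 := (Nat.div_ne_zero_iff_of_dvd hgk).mpr ⟨hk, hg0.ne'⟩
  have hkg : ((k : ℕ) : ℝ) = (g : ℝ) * ((k / g : ℕ) : ℝ) := by exact_mod_cast (Nat.mul_div_cancel' hgk).symm
  have hak : a.Coprime (k / g) := ha.coprime_dvd_right (Nat.div_dvd_of_dvd hgk)
  -- the left side on the fibre: phases `×` a constant real factor
  have hfib : ∑ t ∈ (Finset.range k).filter (fun t => Nat.gcd t k = g),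
      (𝐞 ((a * t : ℝ) / k) : ℂ) * ((((Nat.gcd t k : ℕ) : ℝ) ^ (-α) *
        (∏ p ∈ (k / Nat.gcd t k).primeFactors, (1 - (p : ℝ) ^ (-α))) / ((k / Nat.gcd t k).totient : ℝ) : ℝ) : ℂ) =
      (∑ b ∈ (Finset.range (k / g)).filter (fun b => b.Coprime (k / g)), (𝐞 ((a * b : ℝ) / (k / g : ℕ)) : ℂ)) *
        ((((g : ℕ) : ℝ) ^ (-α) * (∏ p ∈ (k / g).primeFactors, (1 - (p : ℝ) ^ (-α))) / ((k / g).totient : ℝ) : ℝ) : ℂ) := by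
    rw [Finset.sum_mul, filter_range_gcd_eq_image hk hgk,
      Finset.sum_image (fun x _ y _ h => (Nat.mul_right_inj hg0.ne').mp h)]
    refine Finset.sum_congr rfl fun b hb => ?_
    obtain ⟨-, hcop⟩ := Finset.mem_filter.mp hb
    have hgb : Nat.gcd (g * b) k = g := by
      conv_lhs => rw [← Nat.mul_div_cancel' hgk]
      rw [Nat.gcd_mul_left, Nat.Coprime.gcd_eq_one hcop, mul_one]
    rw [hgb]
    have hg0' : (g : ℝ) ≠ 0 := by exact_mod_cast hg0.ne'
    have hphase : ((a * (g * b : ℕ) : ℝ) / k) = (a * b : ℝ) / (k / g : ℕ) := by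
      rw [hkg]; push_cast; field_simp
    rw [hphase]
  -- the right side on the fibre
  have hR : ∑ d ∈ (k / g).divisors, (μ (k / g) : ℝ) * (μ d : ℝ) * ((g * d : ℕ) : ℝ) ^ (-α) / ((k / g).totient : ℝ) =
      (μ (k / g) : ℝ) * (((g : ℕ) : ℝ) ^ (-α) * (∏ p ∈ (k / g).primeFactors, (1 - (p : ℝ) ^ (-α))) /
        ((k / g).totient : ℝ)) := by
    rw [← sum_divisors_moebius_rpow hk'0 α, Finset.mul_sum, Finset.sum_div, Finset.mul_sum]
    refine Finset.sum_congr rfl fun d _ => ?_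
    have hgd : ((g * d : ℕ) : ℝ) ^ (-α) = (g : ℝ) ^ (-α) * (d : ℝ) ^ (-α) := by
      push_cast; exact Real.mul_rpow (Nat.cast_nonneg g) (Nat.cast_nonneg d)
    rw [hgd]; ring
  rw [hfib, hR, sum_coprime_fourierChar_eq_moebius hk'0 hak]
  push_cast
  ring

end SmoothArcs

end Literature.NumberTheory.Sieve

end
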